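import Mathlib
import Summits.ValiantsHypothesis.ValiantsHypothesis.Theorems.KPlusLogSqLawResolvedAlternatingToward
import Summits.ValiantsHypothesis.ValiantsHypothesis.Theorems.KPlusLogSqLawResolvedExchange

/-!
# Route «KPlusLogSqLaw», crux `WeakLifting` (stmt-ValiantsHypothesis-19561) — α row, RESOLVED limit:
# THEOREM A (ii) in the kernel — an alternating word on `N` edges meets at most `N + 1` optimal matchings along increasing time (g17)

HONEST FRAMING.  Helper lemmas (`--supports stmt-ValiantsHypothesis-19561 --as helper`), seat pub-symmetroid-conjb-2 (g17), cell `pub-symmetroid`,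
2026-08-28.  Elementary; def-free; resolved (tropical) limit only; nothing here is a root count and nothing bears on `WeakLifting` / `TropicalB` in
their windows, on Conjecture B (`KPlusLogSqLaw`), on `MatrixDescartes` or on VP ≠ VNP.

CONTENT (paper: HOME/pub-symmetroid-conjb-2/g17/theory/THEORY-NOTE-g17.md §4.7, THEOREM A).  Setting of the companion files (p626562, p626993): edges
`0, …, N − 1` of a path, matchings = finsets `μ ⊆ range N` of pairwise non-consecutive naturals, weight `Σ_{k∈μ} a_k + t Σ_{k∈μ} λ_k`, slopes `λ`
ALTERNATING in sign and nonzero.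
* `toward_of_alternating'` — the toward lemma WITHOUT a shared time: if `μ` is optimal at `t₁` and `μ'` is optimal at `t₂ > t₁`, then `μ' \ μ ⊆ {λ > 0}`
  and `μ \ μ' ⊆ {λ < 0}` (sharpens p626562, which assumed `μ` optimal at `t₂` as well).  Proof: swap the «away» part `A` of `μ ∆ μ'` (adjacency-closed,
  so both swaps are matchings by `ResolvedExchange.swap_nonconsec`); the swap identities and the two optimality inequalities give `slope ν ≥ slope μ`
  for `ν = (μ \ A) ∪ (μ' ∩ A)`, while `A ≠ ∅` forces `slope ν < slope μ`.
* `final_card_lt_of_toward` — the budget: `Φ(μ) := #{e < N : (e ∈ μ ↔ λ_e > 0)}` strictly increases from `μ` to any `μ' ≠ μ` reached by toward flips.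
* `chain_bound_of_alternating` — THEOREM A (ii): if `M₀, …, M_n` are matchings, consecutive ones distinct, `M_k` optimal at time `s_k` with `s` strictly
  increasing, then `n ≤ N`.  In particular the upper envelope of an alternating word has at most `N` breakpoints (at most `m − 1` resolved layers
  for the α row with `m − 1` edges) — the tight class of the resolved door-(A) census.  [this seat; elementary]
-/

-- `Summit.ValiantsHypothesis.ValiantsHypothesis.…` repeats a component by the D-0017 layout (single-conjunct summit); the name is mandated.
set_option linter.dupNamespace false

namespace Summit.ValiantsHypothesis.ValiantsHypothesis.Theorems.KPlusLogSqLaw.ResolvedAlternatingChain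

open Finset
open Summit.ValiantsHypothesis.ValiantsHypothesis.Theorems.KPlusLogSqLaw.ResolvedAlternating (sum_split sum_swap disjoint_sdiff_inter')
open Summit.ValiantsHypothesis.ValiantsHypothesis.Theorems.KPlusLogSqLaw.ResolvedExchange (swap_nonconsec swap_subset_range sum_swap_eq)

/-- THE TOWARD LEMMA WITHOUT A SHARED TIME.  Alternating nonzero slopes; `μ` optimal at `t₁`, `μ'` optimal at `t₂`, `t₁ < t₂`.  Then every edge of
`μ' \ μ` has positive slope and every edge of `μ \ μ'` has negative slope. -/
theorem toward_of_alternating' (N : ℕ) (a lam : ℕ → ℝ)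
    (halt : ∀ i, i + 1 < N → lam i * lam (i + 1) < 0) (hnz : ∀ i, i < N → lam i ≠ 0)
    (t₁ t₂ : ℝ) (ht : t₁ < t₂) (μ μ' : Finset ℕ)
    (hμN : μ ⊆ range N) (hμm : ∀ i ∈ μ, i + 1 ∉ μ) (hμ'N : μ' ⊆ range N) (hμ'm : ∀ i ∈ μ', i + 1 ∉ μ')
    (hopt₁ : ∀ ν : Finset ℕ, ν ⊆ range N → (∀ i ∈ ν, i + 1 ∉ ν) →
      ∑ k ∈ ν, a k + t₁ * ∑ k ∈ ν, lam k ≤ ∑ k ∈ μ, a k + t₁ * ∑ k ∈ μ, lam k)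
    (hopt₂' : ∀ ν : Finset ℕ, ν ⊆ range N → (∀ i ∈ ν, i + 1 ∉ ν) →
      ∑ k ∈ ν, a k + t₂ * ∑ k ∈ ν, lam k ≤ ∑ k ∈ μ', a k + t₂ * ∑ k ∈ μ', lam k) :
    (∀ e ∈ μ' \ μ, 0 < lam e) ∧ (∀ e ∈ μ \ μ', lam e < 0) := by
  classical
  -- the away set and its description
  set A : Finset ℕ := ((μ' \ μ).filter fun i => lam i < 0) ∪ ((μ \ μ').filter fun i => 0 < lam i) with hA
  have hAD : ∀ i ∈ A, (i ∈ μ' ∧ i ∉ μ ∧ lam i < 0) ∨ (i ∈ μ ∧ i ∉ μ' ∧ 0 < lam i) := by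
    intro i hi
    rcases mem_union.1 hi with h | h
    · obtain ⟨h1, h2⟩ := mem_filter.1 h
      exact Or.inl ⟨(mem_sdiff.1 h1).1, (mem_sdiff.1 h1).2, h2⟩
    · obtain ⟨h1, h2⟩ := mem_filter.1 h
      exact Or.inr ⟨(mem_sdiff.1 h1).1, (mem_sdiff.1 h1).2, h2⟩
  have memA : ∀ i, ((i ∈ μ' ∧ i ∉ μ ∧ lam i < 0) ∨ (i ∈ μ ∧ i ∉ μ' ∧ 0 < lam i)) → i ∈ A := by
    intro i h
    rcases h with ⟨h1, h2, h3⟩ | ⟨h1, h2, h3⟩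
    · exact mem_union.2 (Or.inl (mem_filter.2 ⟨mem_sdiff.2 ⟨h1, h2⟩, h3⟩))
    · exact mem_union.2 (Or.inr (mem_filter.2 ⟨mem_sdiff.2 ⟨h1, h2⟩, h3⟩))
  have sign_succ : ∀ i, i + 1 < N → (0 < lam i ↔ lam (i + 1) < 0) := by
    intro i hi
    have h := halt i hi
    constructor
    · intro hp
      by_contra hq
      have : 0 ≤ lam i * lam (i + 1) := mul_nonneg hp.le (not_lt.1 hq)
      linarith
    · intro hq
      by_contra hp
      have : 0 ≤ lam i * lam (i + 1) := mul_nonneg_of_nonpos_of_nonpos (not_lt.1 hp) hq.le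
      linarith
  -- KEY: `A` is closed under adjacency inside the symmetric difference (membership and sign both alternate)
  have closed_up : ∀ i ∈ A, (i + 1 ∈ μ ∨ i + 1 ∈ μ') → ¬ (i + 1 ∈ μ ∧ i + 1 ∈ μ') → i + 1 ∈ A := by
    intro i hi hD _
    have hi1N : i + 1 < N := by
      rcases hD with h | h
      · exact mem_range.1 (hμN h)
      · exact mem_range.1 (hμ'N h)
    have hs := sign_succ i hi1N
    have hnz1 := hnz (i + 1) hi1N
    rcases hAD i hi with ⟨hiμ', _, hneg⟩ | ⟨hiμ, _, hpos⟩
    · have h1 : i + 1 ∉ μ' := hμ'm i hiμ'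
      have h2 : i + 1 ∈ μ := by
        rcases hD with h | h
        · exact h
        · exact absurd h h1
      have h3 : 0 < lam (i + 1) := by
        rcases lt_or_gt_of_ne hnz1 with h | h
        · exact absurd (hs.2 h) (by linarith)
        · exact h
      exact memA _ (Or.inr ⟨h2, h1, h3⟩)
    · have h1 : i + 1 ∉ μ := hμm i hiμ
      have h2 : i + 1 ∈ μ' := by
        rcases hD with h | h
        · exact absurd h h1
        · exact h
      exact memA _ (Or.inl ⟨h2, h1, hs.1 hpos⟩)
  have closed_down : ∀ i, i + 1 ∈ A → (i ∈ μ ∨ i ∈ μ') → ¬ (i ∈ μ ∧ i ∈ μ') → i ∈ A := by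
    intro i hi hD _
    have hi1N : i + 1 < N := by
      rcases hAD (i + 1) hi with ⟨h, _, _⟩ | ⟨h, _, _⟩
      · exact mem_range.1 (hμ'N h)
      · exact mem_range.1 (hμN h)
    have hs := sign_succ i hi1N
    have hnz0 := hnz i (by omega)
    rcases hAD (i + 1) hi with ⟨hiμ', _, hneg⟩ | ⟨hiμ, _, hpos⟩
    · have h1 : i ∉ μ' := fun h => hμ'm i h hiμ'
      have h2 : i ∈ μ := by
        rcases hD with h | h
        · exact h
        · exact absurd h h1
      exact memA _ (Or.inr ⟨h2, h1, hs.2 hneg⟩)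
    · have h1 : i ∉ μ := fun h => hμm i h hiμ
      have h2 : i ∈ μ' := by
        rcases hD with h | h
        · exact absurd h h1
        · exact h
      have h3 : lam i < 0 := by
        rcases lt_or_gt_of_ne hnz0 with h | h
        · exact h
        · exact absurd (hs.1 h) (by linarith)
      exact memA _ (Or.inl ⟨h2, h1, h3⟩)
  -- the same closure seen from the side of μ'
  have closed_up' : ∀ i ∈ A, (i + 1 ∈ μ' ∨ i + 1 ∈ μ) → ¬ (i + 1 ∈ μ' ∧ i + 1 ∈ μ) → i + 1 ∈ A :=
    fun i hi h1 h2 => closed_up i hi h1.symm (fun hh => h2 ⟨hh.2, hh.1⟩)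
  have closed_down' : ∀ i, i + 1 ∈ A → (i ∈ μ' ∨ i ∈ μ) → ¬ (i ∈ μ' ∧ i ∈ μ) → i ∈ A :=
    fun i hi h1 h2 => closed_down i hi h1.symm (fun hh => h2 ⟨hh.2, hh.1⟩)
  -- the two swaps are matchings
  have hνm := swap_nonconsec μ μ' A hμm hμ'm closed_up closed_down
  have hνN := swap_subset_range N μ μ' A hμN hμ'N
  have hν'm := swap_nonconsec μ' μ A hμ'm hμm closed_up' closed_down'
  have hν'N := swap_subset_range N μ' μ A hμ'N hμN
  -- optimality inequalities and the swap identities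
  have hW₁ := hopt₁ _ hνN hνm
  have hW₂ := hopt₂' _ hν'N hν'm
  have hsa := sum_swap a μ μ' A
  have hsl := sum_swap lam μ μ' A
  have hslope := sum_swap_eq lam μ μ' A
  by_cases hAne : A.Nonempty
  · exfalso
    have hstrict : ∑ k ∈ μ \ A ∪ μ' ∩ A, lam k < ∑ k ∈ μ, lam k := by
      rw [hslope]
      have hnonpos : ∑ k ∈ μ' ∩ A, lam k ≤ 0 := by
        refine sum_nonpos fun j hj => ?_
        rcases hAD j (mem_inter.1 hj).2 with ⟨_, _, h⟩ | ⟨_, h, _⟩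
        · exact h.le
        · exact absurd (mem_inter.1 hj).1 h
      have hnonneg : 0 ≤ ∑ k ∈ μ ∩ A, lam k := by
        refine sum_nonneg fun j hj => ?_
        rcases hAD j (mem_inter.1 hj).2 with ⟨_, h, _⟩ | ⟨_, _, h⟩
        · exact absurd (mem_inter.1 hj).1 h
        · exact h.le
      obtain ⟨i, hi⟩ := hAne
      rcases hAD i hi with ⟨hiμ', hiμ, hneg⟩ | ⟨hiμ, hiμ', hpos⟩
      · have : ∑ k ∈ μ' ∩ A, lam k < 0 := by
          refine sum_neg (fun j hj => ?_) ⟨i, mem_inter.2 ⟨hiμ', hi⟩⟩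
          rcases hAD j (mem_inter.1 hj).2 with ⟨_, _, h⟩ | ⟨_, h, _⟩
          · exact h
          · exact absurd (mem_inter.1 hj).1 h
        linarith
      · have : 0 < ∑ k ∈ μ ∩ A, lam k := by
          refine sum_pos (fun j hj => ?_) ⟨i, mem_inter.2 ⟨hiμ, hi⟩⟩
          rcases hAD j (mem_inter.1 hj).2 with ⟨_, h, _⟩ | ⟨_, _, h⟩
          · exact absurd (mem_inter.1 hj).1 h
          · exact h
        linarith
    -- from hW₂ and the identities: W ν t₂ ≥ W μ t₂; from hW₁: W ν t₁ ≤ W μ t₁; slope ν < slope μ and t₁ < t₂ contradict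
    have h3 := congrArg (fun x => t₂ * x) hsl
    simp only [mul_add] at h3
    have hlt : (t₂ - t₁) * ∑ k ∈ μ \ A ∪ μ' ∩ A, lam k < (t₂ - t₁) * ∑ k ∈ μ, lam k :=
      mul_lt_mul_of_pos_left hstrict (by linarith)
    nlinarith [hW₁, hW₂, hsa, h3, hlt]
  · rw [not_nonempty_iff_eq_empty] at hAne
    constructor
    · intro e he
      obtain ⟨heμ', heμ⟩ := mem_sdiff.1 he
      rcases lt_or_gt_of_ne (hnz e (mem_range.1 (hμ'N heμ'))) with h | h
      · have : e ∈ A := memA e (Or.inl ⟨heμ', heμ, h⟩)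
        rw [hAne] at this
        exact absurd this (Finset.notMem_empty e)
      · exact h
    · intro e he
      obtain ⟨heμ, heμ'⟩ := mem_sdiff.1 he
      rcases lt_or_gt_of_ne (hnz e (mem_range.1 (hμN heμ))) with h | h
      · exact h
      · have : e ∈ A := memA e (Or.inr ⟨heμ, heμ', h⟩)
        rw [hAne] at this
        exact absurd this (Finset.notMem_empty e)

/-- THE BUDGET.  If `μ' ≠ μ` is reached from `μ` by toward flips only (`μ' \ μ ⊆ {λ > 0}`, `μ \ μ' ⊆ {λ < 0}`), the number of edges in FINAL
position, `#{e < N : (e ∈ μ ↔ λ_e > 0)}`, strictly increases. -/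
theorem final_card_lt_of_toward (N : ℕ) (lam : ℕ → ℝ) (μ μ' : Finset ℕ) (hμN : μ ⊆ range N) (hμ'N : μ' ⊆ range N)
    (hne : μ ≠ μ') (hin : ∀ e ∈ μ' \ μ, 0 < lam e) (hout : ∀ e ∈ μ \ μ', lam e < 0) :
    ((range N).filter fun e => (e ∈ μ ↔ 0 < lam e)).card < ((range N).filter fun e => (e ∈ μ' ↔ 0 < lam e)).card := by
  classical
  apply card_lt_card
  rw [Finset.ssubset_iff_subset_ne]
  constructor
  · intro e he
    obtain ⟨heN, hiff⟩ := mem_filter.1 he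
    refine mem_filter.2 ⟨heN, ?_⟩
    by_cases heμ : e ∈ μ
    · have hpos : 0 < lam e := hiff.1 heμ
      have heμ' : e ∈ μ' := by
        by_contra h
        have := hout e (mem_sdiff.2 ⟨heμ, h⟩)
        linarith
      exact ⟨fun _ => hpos, fun _ => heμ'⟩
    · have hnpos : ¬ 0 < lam e := fun h => heμ (hiff.2 h)
      have heμ' : e ∉ μ' := fun h => hnpos (hin e (mem_sdiff.2 ⟨h, heμ⟩))
      exact ⟨fun h => absurd h heμ', fun h => absurd h hnpos⟩
  · intro hEq
    apply hne
    ext e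
    constructor
    · intro heμ
      by_contra h
      have hneg := hout e (mem_sdiff.2 ⟨heμ, h⟩)
      have he' : e ∈ (range N).filter fun e => (e ∈ μ' ↔ 0 < lam e) :=
        mem_filter.2 ⟨hμN heμ, ⟨fun h' => absurd h' h, fun h' => absurd h' (by linarith)⟩⟩
      rw [← hEq] at he'
      have := (mem_filter.1 he').2.1 heμ
      linarith
    · intro heμ'
      by_contra h
      have hpos := hin e (mem_sdiff.2 ⟨heμ', h⟩)
      have he' : e ∈ (range N).filter fun e => (e ∈ μ' ↔ 0 < lam e) :=
        mem_filter.2 ⟨hμ'N heμ', ⟨fun _ => hpos, fun _ => heμ'⟩⟩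
      rw [← hEq] at he'
      exact h ((mem_filter.1 he').2.2 hpos)

/-- THEOREM A (ii) (THEORY-NOTE-g17 §4.7), kernel form.  Alternating nonzero slopes on `N` edges; `M₀, …, M_n` matchings with consecutive ones
distinct; `M_k` optimal at time `s_k`; `s` strictly increasing.  Then `n ≤ N`: an alternating word meets at most `N + 1` distinct optimal matchings
along increasing time, i.e. its envelope has at most `N` breakpoints. -/
theorem chain_bound_of_alternating (N : ℕ) (a lam : ℕ → ℝ)
    (halt : ∀ i, i + 1 < N → lam i * lam (i + 1) < 0) (hnz : ∀ i, i < N → lam i ≠ 0)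
    (n : ℕ) (s : Fin (n + 1) → ℝ) (hs : StrictMono s) (M : Fin (n + 1) → Finset ℕ)
    (hMN : ∀ k, M k ⊆ range N) (hMm : ∀ k, ∀ i ∈ M k, i + 1 ∉ M k)
    (hopt : ∀ k, ∀ ν : Finset ℕ, ν ⊆ range N → (∀ i ∈ ν, i + 1 ∉ ν) →
      ∑ j ∈ ν, a j + s k * ∑ j ∈ ν, lam j ≤ ∑ j ∈ M k, a j + s k * ∑ j ∈ M k, lam j)
    (hdist : ∀ k : Fin n, M k.castSucc ≠ M k.succ) : n ≤ N := by
  classical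
  -- Φ(M_k) ≥ k for every k ≤ n
  have key : ∀ k, (hk : k < n + 1) → k ≤ ((range N).filter fun e => (e ∈ M ⟨k, hk⟩ ↔ 0 < lam e)).card := by
    intro k
    induction k with
    | zero => intro _; exact Nat.zero_le _
    | succ k ih =>
      intro hk
      have hk' : k < n + 1 := by omega
      have h0 := ih hk'
      have hlt : (⟨k, hk'⟩ : Fin (n + 1)) < ⟨k + 1, hk⟩ := Fin.mk_lt_mk.2 (Nat.lt_succ_self k)
      have hst : s ⟨k, hk'⟩ < s ⟨k + 1, hk⟩ := hs hlt
      have hne : M ⟨k, hk'⟩ ≠ M ⟨k + 1, hk⟩ := by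
        have := hdist ⟨k, by omega⟩
        simpa [Fin.castSucc_mk, Fin.succ_mk] using this
      obtain ⟨hin, hout⟩ := toward_of_alternating' N a lam halt hnz (s ⟨k, hk'⟩) (s ⟨k + 1, hk⟩) hst
        (M ⟨k, hk'⟩) (M ⟨k + 1, hk⟩) (hMN _) (hMm _) (hMN _) (hMm _) (hopt _) (hopt _)
      have hstep := final_card_lt_of_toward N lam (M ⟨k, hk'⟩) (M ⟨k + 1, hk⟩) (hMN _) (hMN _) hne hin hout
      omega
  have hn := key n (Nat.lt_succ_self n)
  have hcard : ((range N).filter fun e => (e ∈ M ⟨n, Nat.lt_succ_self n⟩ ↔ 0 < lam e)).card ≤ N := by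
    calc ((range N).filter fun e => (e ∈ M ⟨n, Nat.lt_succ_self n⟩ ↔ 0 < lam e)).card ≤ (range N).card := card_filter_le _ _
      _ = N := card_range N
  omega

end Summit.ValiantsHypothesis.ValiantsHypothesis.Theorems.KPlusLogSqLaw.ResolvedAlternatingChain
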